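import Summits.QuantumFields.YangMills.Theorems.BalabanUVNodesN14ConvexFibreEngine
import Summits.QuantumFields.YangMills.Theorems.FluctuationComparisonRegPrIntLTailSupOneGaussianTail
import HarnessLib

/-!
# `FluctuationComparisonRegPrIntLTailSupOneConvexTail` — LINE g21-2 «DEPTH-ONE WINDOW ODDS BY A MEASURE SPLIT»: THE NON-GAUSSIAN ENGINE OF MOD₁ —
# DIMENSION-FREE WINDOW ODDS FROM UNIFORM CONVEXITY OF THE FIBRE ACTION (Bakry–Émery ∘ Herbst, both PROVED in the tree)
# (crux `UnitScaleTilt.FluctuationComparisonRegPrIntL`, stmt-QuantumFields-20520; row MOD₁ `ModerateFieldOddsDepthOneCan` of `Cruxes/…/Lines/tailsup_one.lean`,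
# ideator ym-r3-idea-1 g21; engine = Track A's ✓`YMDAG.N14.ConvexFibreEngine.hasSubgaussianMGF_of_uniformlyConvex`)

Cell `ym3-torus` (YM ladder rung R3 = continuum SU(2) Yang–Mills on T³ — a RUNG, NOT the Clay problem: not d = 4, not infinite volume, not a mass gap);
width seat `ym-ust-20520-w3` (gen 17); helper `--supports stmt-QuantumFields-20520`.  THEOREMS ONLY (0 `def`, 0 `sorry`, default heartbeats).

WHY.  The Gaussian proxy ✓`…TailSupOneGaussianTail` (`N(0, g²M⁻¹)`: window odds `≤ 2N·e^{−m·p(g)²∕2R²}`, coupling cancels) is a PROXY: the one-step constrained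
fibre law is not Gaussian.  But its mechanism needs only UNIFORM LOG-CONCAVITY, not Gaussianity — and that is MOD₁'s stated content («positivity of the fluctuation
operator for small fields», [Balaban1985UV3] (38)–(41); the depth-one shadow of GAP♯): in chart coordinates `z ∈ ℝⁿ` the moderate-field fibre law is
`e^{−V(z)}dz∕Z` with `V = g⁻²·Ψ`, `Ψ` `m`-uniformly convex.  By Bakry–Émery ∘ Herbst (Track A's convex-fibre engine, PROVED) every `C¹` observable with gradient
`≤ L` is sub-Gaussian about its mean with parameter `L²∕λ`, `λ = m∕g²` — DIMENSION-FREE, so no `e^{O(volume)}` is lost, which is exactly what a naive two-sided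
Gaussian sandwich of the fibre density would lose.
* §0 `maxTail_of_hasSubgaussianMGF` — union bound for a finite sub-Gaussian family (generic).
* §1 ★★`convex_maxTail` — `ν = e^{−V}dx∕Z` on `ℝⁿ`, `V` `λ`-uniformly convex (first-order form), a finite family of bounded `C¹` observables `G_p` with
  `‖DG_p‖ ≤ L`: `ν{x | ∃ p ∈ s, t ≤ |G_p x − ∫G_p dν|} ≤ 2·#s·exp(−λ·t²∕(2L²))` (engine + §0).  The BOX ∕ CONVEX-SET editions (the letter MOD₁'s chart
  region really has: `𝟙_Ω e^{−V}dz∕Z`, Track A's ✓`…N14ConvexFibreBox`) are the companion file `…TailSupOneConvexTailBox` (px20), over §0 and D's modulus by name.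
* §2 ★★`convex_maxTail_coupling_cancels` — `λ = m∕g²`, thresholds `g·t`: the bound is `2·#s·exp(−m·t²∕(2L²))`, `g`-free; ★`convex_maxTail_of_centred` — if moreover
  the means are small, `|∫G_p dν| ≤ g·t∕2` (the minimiser's plaquettes sit deep inside the finer window: the WINDOW-EDGE FORCING NUMBER of the card's falsifier
  (a)), then the UNCENTRED odds `ν{∃ p, g·t ≤ |G_p|}` are `≤ 2·#s·exp(−m·t²∕(8L²))`.
* §3 ★`convexWindowOdds_le` — thresholds `θBal L γ b₀ p₀ i = g_i·p(g_i)`: `≤ 2·#s·exp(−(m∕4)·pFun b₀ p₀ g_i²∕(2L²))`, whose level sums are `≤ A'·2^{−J}` and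
  super-polynomial by ✓`…TailSupOneGaussianTail.gaussianWindowOdds_levelSum_le` ∕ `…_superpoly` at `m ↦ m∕4`, `R² ↦ L²` (same shape, by name).
So MOD₁ ⟸ (chart of the moderate region of the fibre over every window datum as `e^{−g⁻²Ψ}dz`, `Ψ` `m`-convex uniformly in the datum) ∧ (plaquette
observables `C¹` with chart-gradient `≤ L`) ∧ (centring `≤ θ_{J+1}∕2`) — three named, finite-dimensional obligations; the probability is DONE here.
HONEST SCOPE.  Abstract engine; the three obligations are MOD₁'s content and are NOT proved; MOD₁, FAR₁, TAILSUP₁, LFR♯ᶜ, S2β, 20520, `YM3TorusSU2` NOT proved;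
the Yang–Mills mass gap is NOT proved.
References: [BakryGentilLedoux2014] Prop. 5.4.1 (Herbst), Cor. 5.7.2 (Bakry–Émery); [Balaban1985UV3] (7) p. 257, (38)–(41) p. 266; [BoucheronLugosiMassart2013] §2.5.
-/

noncomputable section

set_option autoImplicit false

open MeasureTheory ProbabilityTheory Filter Topology Set
open scoped RealInnerProductSpace ENNReal NNReal BigOperators
open Literature.MathematicalPhysics.QuantumFieldTheory.Balaban1983to89
open Literature.MathematicalPhysics.QuantumFieldTheory.Balaban1983to89.T3ContinuumYM3Torus
open Literature.MathematicalPhysics.QuantumFieldTheory.Balaban1983to89.T3UnitLawDensityEML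
open Literature.MathematicalPhysics.QuantumFieldTheory.Balaban1983to89.T3UnitScaleTilt
open Literature.Analysis.FunctionSpaces (isProbabilityMeasure_tilted_neg)
open YMDAG.N14.ConvexFibreEngine (hasSubgaussianMGF_of_uniformlyConvex)

namespace Summit.QuantumFields.YangMills.Theorems.FluctuationComparisonRegPrIntLTailSupOneConvexTail

variable {n : ℕ}

/-! ## §0 Generic: the max-tail of a finite family of sub-Gaussian observables -/

/-- **UNION BOUND FOR A FINITE SUB-GAUSSIAN FAMILY** (finite `ν`): if every `X_p` (`p ∈ s`) has `HasSubgaussianMGF X_p c ν` then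
`ν{x | ∃ p ∈ s, t ≤ |X_p x|} ≤ 2·#s·exp(−t²∕(2c))` for `t ≥ 0` (Chernoff for `±X_p`, union bound). [cite: BoucheronLugosiMassart2013, §2.5] -/
theorem maxTail_of_hasSubgaussianMGF {X : Type*} [MeasurableSpace X] (ν : Measure X) [IsFiniteMeasure ν] {A : Type*} (s : Finset A) (Y : A → X → ℝ) (c : ℝ≥0)
    (h : ∀ p ∈ s, HasSubgaussianMGF (Y p) c ν) {t : ℝ} (ht : 0 ≤ t) :
    ν.real {x | ∃ p ∈ s, t ≤ |Y p x|} ≤ 2 * s.card * Real.exp (-t ^ 2 / (2 * c)) := by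
  have hone : ∀ p ∈ s, ν.real {x | t ≤ |Y p x|} ≤ 2 * Real.exp (-t ^ 2 / (2 * c)) := by
    intro p hp
    have h1 := (h p hp).measure_ge_le ht
    have h2 := (h p hp).neg.measure_ge_le ht
    have hsub : {x | t ≤ |Y p x|} ⊆ {x | t ≤ Y p x} ∪ {x | t ≤ (-Y p) x} := by
      intro x hx
      simp only [Set.mem_setOf_eq, Set.mem_union, Pi.neg_apply] at hx ⊢
      rcases le_abs.mp hx with h | h
      · exact Or.inl h
      · exact Or.inr h
    calc ν.real {x | t ≤ |Y p x|}
        ≤ ν.real ({x | t ≤ Y p x} ∪ {x | t ≤ (-Y p) x}) := measureReal_mono hsub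
      _ ≤ ν.real {x | t ≤ Y p x} + ν.real {x | t ≤ (-Y p) x} := measureReal_union_le _ _
      _ ≤ Real.exp (-t ^ 2 / (2 * c)) + Real.exp (-t ^ 2 / (2 * c)) := add_le_add h1 h2
      _ = 2 * Real.exp (-t ^ 2 / (2 * c)) := by ring
  have hset : {x | ∃ p ∈ s, t ≤ |Y p x|} = ⋃ p ∈ s, {x | t ≤ |Y p x|} := by
    ext x; simp
  rw [hset]
  refine (measureReal_biUnion_finset_le s _).trans ?_
  calc ∑ p ∈ s, ν.real {x | t ≤ |Y p x|}
      ≤ ∑ p ∈ s, 2 * Real.exp (-t ^ 2 / (2 * c)) := Finset.sum_le_sum fun p hp => hone p hp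
    _ = 2 * s.card * Real.exp (-t ^ 2 / (2 * c)) := by rw [Finset.sum_const, nsmul_eq_mul]; ring

/-! ## §1 The max-tail of a finite family of `C¹` observables under a uniformly log-concave law (whole space) -/

section Convex

variable {V : EuclideanSpace ℝ (Fin n) → ℝ} {lam : ℝ}

/-- ★★ **DIMENSION-FREE MAX-TAIL UNDER A UNIFORMLY LOG-CONCAVE LAW**: `ν = e^{−V}dx∕Z` with `V` continuous, `λ`-uniformly convex (first-order form) and `e^{−V}`
integrable; `G_p` (`p ∈ s`) bounded `C¹` observables with `‖DG_p‖ ≤ L` (`L > 0`); `t ≥ 0`.  Then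
`ν{x | ∃ p ∈ s, t ≤ |G_p x − ∫G_p dν|} ≤ 2·#s·exp(−λ·t²∕(2L²))` — ✓`hasSubgaussianMGF_of_uniformlyConvex` (Bakry–Émery ∘ Herbst) for `±(G_p − mean)`, Chernoff
(`HasSubgaussianMGF.measure_ge_le`), union bound. [cite: BakryGentilLedoux2014, Prop. 5.4.1; BoucheronLugosiMassart2013, §2.5] -/
theorem convex_maxTail (hlam : 0 < lam) (hVc : Continuous V)
    (hV : ∀ x y : EuclideanSpace ℝ (Fin n), V x + ⟪gradient V x, y - x⟫ + lam / 2 * ‖y - x‖ ^ 2 ≤ V y)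
    (hZ : Integrable fun x => Real.exp (-V x))
    {A : Type*} (s : Finset A) (G : A → EuclideanSpace ℝ (Fin n) → ℝ) (B : A → ℝ) {L : ℝ} (hL : 0 < L)
    (hG : ∀ p ∈ s, ContDiff ℝ 1 (G p)) (hGb : ∀ p ∈ s, ∀ x, |G p x| ≤ B p) (hGD : ∀ p ∈ s, ∀ x, ‖fderiv ℝ (G p) x‖ ≤ L)
    {t : ℝ} (ht : 0 ≤ t) :
    ((volume : Measure (EuclideanSpace ℝ (Fin n))).tilted fun x => -V x).real
        {x | ∃ p ∈ s, t ≤ |G p x - ∫ z, G p z ∂((volume : Measure (EuclideanSpace ℝ (Fin n))).tilted fun x => -V x)|} ≤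
      2 * s.card * Real.exp (-(lam * t ^ 2 / (2 * L ^ 2))) := by
  set ν : Measure (EuclideanSpace ℝ (Fin n)) := (volume : Measure (EuclideanSpace ℝ (Fin n))).tilted fun x => -V x with hν
  haveI : IsProbabilityMeasure ν := isProbabilityMeasure_tilted_neg hZ
  have hsg : ∀ p ∈ s, HasSubgaussianMGF (fun x => G p x - ∫ z, G p z ∂ν) ⟨L ^ 2 / lam, by positivity⟩ ν := fun p hp =>
    hasSubgaussianMGF_of_uniformlyConvex hlam hVc hV hZ (hG p hp) (hGb p hp) (hGD p hp) hL
  calc ν.real {x | ∃ p ∈ s, t ≤ |G p x - ∫ z, G p z ∂ν|}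
      ≤ 2 * s.card * Real.exp (-t ^ 2 / (2 * ((⟨L ^ 2 / lam, by positivity⟩ : ℝ≥0) : ℝ))) :=
        maxTail_of_hasSubgaussianMGF ν s (fun p x => G p x - ∫ z, G p z ∂ν) ⟨L ^ 2 / lam, by positivity⟩ hsg ht
    _ = 2 * s.card * Real.exp (-(lam * t ^ 2 / (2 * L ^ 2))) := by
        rw [show -t ^ 2 / (2 * ((⟨L ^ 2 / lam, by positivity⟩ : ℝ≥0) : ℝ)) = -(lam * t ^ 2 / (2 * L ^ 2)) from by
          push_cast; field_simp]

/-- ★★ **THE COUPLING CANCELS (log-concave edition)**: if the fibre action is `V = g⁻²·Ψ` with `Ψ` `m`-convex — i.e. `V` is `(m∕g²)`-uniformly convex — then at the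
physical thresholds `g·t` the max-tail is `2·#s·exp(−m·t²∕(2L²))`, independent of the coupling `g > 0`: exactly the Gaussian proxy's bound
(✓`…TailSupOneGaussianTail.gaussian_maxTail_coupling_cancels`) WITHOUT Gaussianity. [cite: BakryGentilLedoux2014, Prop. 5.4.1; Balaban1985UV3, (38)-(41) p.266] -/
theorem convex_maxTail_coupling_cancels {m g : ℝ} (hm : 0 < m) (hg : 0 < g) (hVc : Continuous V)
    (hV : ∀ x y : EuclideanSpace ℝ (Fin n), V x + ⟪gradient V x, y - x⟫ + (m / g ^ 2) / 2 * ‖y - x‖ ^ 2 ≤ V y)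
    (hZ : Integrable fun x => Real.exp (-V x))
    {A : Type*} (s : Finset A) (G : A → EuclideanSpace ℝ (Fin n) → ℝ) (B : A → ℝ) {L : ℝ} (hL : 0 < L)
    (hG : ∀ p ∈ s, ContDiff ℝ 1 (G p)) (hGb : ∀ p ∈ s, ∀ x, |G p x| ≤ B p) (hGD : ∀ p ∈ s, ∀ x, ‖fderiv ℝ (G p) x‖ ≤ L)
    {t : ℝ} (ht : 0 ≤ t) :
    ((volume : Measure (EuclideanSpace ℝ (Fin n))).tilted fun x => -V x).real
        {x | ∃ p ∈ s, g * t ≤ |G p x - ∫ z, G p z ∂((volume : Measure (EuclideanSpace ℝ (Fin n))).tilted fun x => -V x)|} ≤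
      2 * s.card * Real.exp (-(m * t ^ 2 / (2 * L ^ 2))) := by
  have h := convex_maxTail (div_pos hm (pow_pos hg 2)) hVc hV hZ s G B hL hG hGb hGD (mul_nonneg hg.le ht)
  have hexp : -(m / g ^ 2 * (g * t) ^ 2 / (2 * L ^ 2)) = -(m * t ^ 2 / (2 * L ^ 2)) := by
    field_simp
  rwa [hexp] at h

/-- ★ **CENTRING BY THE WINDOW-EDGE FORCING NUMBER**: if in addition every mean is small, `|∫G_p dν| ≤ g·t∕2` (the one-step minimiser's fine plaquettes sit at
most half-way to the finer threshold — the card's falsifier (a)), then the UNCENTRED window odds obey `ν{∃ p ∈ s, g·t ≤ |G_p|} ≤ 2·#s·exp(−m·t²∕(8L²))`.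
[cite: Balaban1985Variational, Thm 1 (9)-(10) p.279; BakryGentilLedoux2014, Prop. 5.4.1] -/
theorem convex_maxTail_of_centred {m g : ℝ} (hm : 0 < m) (hg : 0 < g) (hVc : Continuous V)
    (hV : ∀ x y : EuclideanSpace ℝ (Fin n), V x + ⟪gradient V x, y - x⟫ + (m / g ^ 2) / 2 * ‖y - x‖ ^ 2 ≤ V y)
    (hZ : Integrable fun x => Real.exp (-V x))
    {A : Type*} (s : Finset A) (G : A → EuclideanSpace ℝ (Fin n) → ℝ) (B : A → ℝ) {L : ℝ} (hL : 0 < L)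
    (hG : ∀ p ∈ s, ContDiff ℝ 1 (G p)) (hGb : ∀ p ∈ s, ∀ x, |G p x| ≤ B p) (hGD : ∀ p ∈ s, ∀ x, ‖fderiv ℝ (G p) x‖ ≤ L)
    {t : ℝ} (ht : 0 ≤ t)
    (hmean : ∀ p ∈ s, |∫ z, G p z ∂((volume : Measure (EuclideanSpace ℝ (Fin n))).tilted fun x => -V x)| ≤ g * t / 2) :
    ((volume : Measure (EuclideanSpace ℝ (Fin n))).tilted fun x => -V x).real {x | ∃ p ∈ s, g * t ≤ |G p x|} ≤
      2 * s.card * Real.exp (-(m * t ^ 2 / (8 * L ^ 2))) := by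
  set ν : Measure (EuclideanSpace ℝ (Fin n)) := (volume : Measure (EuclideanSpace ℝ (Fin n))).tilted fun x => -V x with hν
  haveI : IsProbabilityMeasure ν := isProbabilityMeasure_tilted_neg hZ
  -- `|G| ≥ g t` and `|mean| ≤ g t / 2` force `|G − mean| ≥ g (t/2)`
  have hsub : {x | ∃ p ∈ s, g * t ≤ |G p x|} ⊆ {x | ∃ p ∈ s, g * (t / 2) ≤ |G p x - ∫ z, G p z ∂ν|} := by
    rintro x ⟨p, hp, hx⟩
    refine ⟨p, hp, ?_⟩
    have h1 : |G p x| - |∫ z, G p z ∂ν| ≤ |G p x - ∫ z, G p z ∂ν| := abs_sub_abs_le_abs_sub _ _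
    have h2 := hmean p hp
    linarith
  have h := convex_maxTail_coupling_cancels hm hg hVc hV hZ s G B hL hG hGb hGD (t := t / 2) (by linarith)
  have hexp : -(m * (t / 2) ^ 2 / (2 * L ^ 2)) = -(m * t ^ 2 / (8 * L ^ 2)) := by ring
  rw [hexp] at h
  exact (measureReal_mono hsub).trans h

end Convex

/-! ## §2 In the tree's profile: thresholds `θBal L γ b₀ p₀ i = g_i·p(g_i)`; the modulus is the Gaussian file's, by name -/

section Profile

variable {V : EuclideanSpace ℝ (Fin n) → ℝ}

/-- ★ **LOG-CONCAVE WINDOW ODDS AT LEVEL `i`**: fibre action `(m∕g_i²)`-uniformly convex in chart coordinates, `g_i = √(γL^{−i})`, plaquette observables `C¹` with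
chart-gradient `≤ L` and means `≤ θ_i∕2`: the odds that some observable leaves the level-`i` window `θBal L γ b₀ p₀ i` are
`≤ 2·#s·exp(−(m∕4)·pFun b₀ p₀ g_i²∕(2L²))` — the shape of ✓`…TailSupOneGaussianTail.gaussianWindowOdds_le` with `m ↦ m∕4`, `R² ↦ L²`, so its level sums over the
free levels are `≤ A'·2^{−J}` and super-polynomial by ✓`gaussianWindowOdds_levelSum_le` ∕ ✓`gaussianWindowOdds_superpoly` BY NAME (`0 < γ ≤ 1`, `1 ≤ L_fam`, `p₀ ≥ 1`).
[cite: Balaban1985UV3, (7) p.257 and (38)-(41) p.266; BakryGentilLedoux2014, Prop. 5.4.1] -/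
theorem convexWindowOdds_le {m : ℝ} (hm : 0 < m) {Lfam : ℕ} (hLfam : 1 ≤ Lfam) {γ b₀ : ℝ} (hγ : 0 < γ) (hγ1 : γ ≤ 1) (hb₀ : 0 ≤ b₀)
    (p₀ : ℝ) (i : ℕ) (hVc : Continuous V)
    (hV : ∀ x y : EuclideanSpace ℝ (Fin n),
      V x + ⟪gradient V x, y - x⟫ + (m / (Real.sqrt (γ * ((Lfam : ℝ)⁻¹) ^ i)) ^ 2) / 2 * ‖y - x‖ ^ 2 ≤ V y)
    (hZ : Integrable fun x => Real.exp (-V x))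
    {A : Type*} (s : Finset A) (G : A → EuclideanSpace ℝ (Fin n) → ℝ) (B : A → ℝ) {L : ℝ} (hL : 0 < L)
    (hG : ∀ p ∈ s, ContDiff ℝ 1 (G p)) (hGb : ∀ p ∈ s, ∀ x, |G p x| ≤ B p) (hGD : ∀ p ∈ s, ∀ x, ‖fderiv ℝ (G p) x‖ ≤ L)
    (hmean : ∀ p ∈ s, |∫ z, G p z ∂((volume : Measure (EuclideanSpace ℝ (Fin n))).tilted fun x => -V x)| ≤ θBal Lfam γ b₀ p₀ i / 2) :
    ((volume : Measure (EuclideanSpace ℝ (Fin n))).tilted fun x => -V x).real {x | ∃ p ∈ s, θBal Lfam γ b₀ p₀ i ≤ |G p x|} ≤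
      2 * s.card * Real.exp (-(m / 4 * B10.pFun b₀ p₀ (Real.sqrt (γ * ((Lfam : ℝ)⁻¹) ^ i)) ^ 2 / (2 * L ^ 2))) := by
  have hLpos : (0 : ℝ) < Lfam := by exact_mod_cast hLfam
  have hg : 0 < Real.sqrt (γ * ((Lfam : ℝ)⁻¹) ^ i) := Real.sqrt_pos.mpr (mul_pos hγ (pow_pos (inv_pos.mpr hLpos) i))
  have hLinv : ((Lfam : ℝ)⁻¹) ^ i ≤ 1 := pow_le_one₀ (inv_nonneg.mpr hLpos.le) (inv_le_one_of_one_le₀ (by exact_mod_cast hLfam))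
  have hg1 : Real.sqrt (γ * ((Lfam : ℝ)⁻¹) ^ i) ≤ 1 := by
    rw [← Real.sqrt_one]
    exact Real.sqrt_le_sqrt (by nlinarith [pow_nonneg (inv_nonneg.mpr hLpos.le) i])
  have hp : 0 ≤ B10.pFun b₀ p₀ (Real.sqrt (γ * ((Lfam : ℝ)⁻¹) ^ i)) := by
    unfold B10.pFun
    refine mul_nonneg hb₀ (Real.rpow_nonneg ?_ _)
    have hlog : 0 ≤ Real.log (Real.sqrt (γ * ((Lfam : ℝ)⁻¹) ^ i))⁻¹ := Real.log_nonneg ((one_le_inv₀ hg).mpr hg1)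
    linarith
  have hmean' : ∀ p ∈ s, |∫ z, G p z ∂((volume : Measure (EuclideanSpace ℝ (Fin n))).tilted fun x => -V x)| ≤
      Real.sqrt (γ * ((Lfam : ℝ)⁻¹) ^ i) * B10.pFun b₀ p₀ (Real.sqrt (γ * ((Lfam : ℝ)⁻¹) ^ i)) / 2 := hmean
  have h := convex_maxTail_of_centred hm hg hVc hV hZ s G B hL hG hGb hGD hp hmean'
  have hexp : -(m * B10.pFun b₀ p₀ (Real.sqrt (γ * ((Lfam : ℝ)⁻¹) ^ i)) ^ 2 / (8 * L ^ 2)) =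
      -(m / 4 * B10.pFun b₀ p₀ (Real.sqrt (γ * ((Lfam : ℝ)⁻¹) ^ i)) ^ 2 / (2 * L ^ 2)) := by ring
  rw [hexp] at h
  exact h

end Profile

end Summit.QuantumFields.YangMills.Theorems.FluctuationComparisonRegPrIntLTailSupOneConvexTail

end
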